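import Mathlib
import HarnessLib

/-!
# Route `VirialFluxGap` (YangMills): WINDOW ARITHMETIC for the «tauber» line of the crux `SharpTwistedLaplace` (stmt-QuantumFields-24204)

Stub `stub_windowArithmetic : WindowArithmetic` of the BC3 skeleton LINE «tauber» (planner ym-idea-4 g14, HOME
bc/g14-A/split/SharpTwistedLaplace_birth.lean, critic PASS 07:33Z): pure asymptotics on Laplace windows `L ≤ β^a`.  Given the volume-law
constants `K₁ > 0`, `q₁ ≥ 0`, with `a := 1/(4(2q₁+9))` and `β ≥ max 2 M²`, `M := 7744·K₁·(1 + K₁ + |log K₁| + q₁ + 4) + 20K₁ + 2`, every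
`1 ≤ L ≤ β^a` and `|w| ≤ K₁L^{q₁}` satisfy the three thresholds of the Tauberian transfer (`2 ≤ β`, `2(κ(9L⁴+1)+1) ≤ β`,
`64(9L⁴+2)²(1 + |w| + |log κ⁻¹| + log β) ≤ β/κ` with `κ = K₁L^{q₁}`) and the error repackaging
`(4κ(9L⁴+1)+4)/β ≤ (40K₁+8)·L^{q₁+4}/β`.  Mechanism: every monomial `L^s`, `s ≤ 2q₁+9`, is `≤ β^{1/4}`, and `log β ≤ 4β^{1/4}`
(`Real.log_le_rpow_div`), so all left-hand sides are `≤ M·β^{1/2} ≤ β`.  The statement below (`windowArithmetic`) is the stub's Prop verbatim, so the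
skeleton's stub closes by `exact windowArithmetic`.

HONEST FRAMING: an S/M stub (bookkeeping) of an evidence skeleton (DRAFT-by-design line); the heart `VolumeExponent`, the crux 24204 and the leaf
are OPEN; no rung / summit statement is proved; the Yang–Mills mass gap is NOT proved.  THEOREMS ONLY (0 `def`, 0 `sorry`), standard axioms.
References: [cite: Luscher1983, §2]; [cite: TomboulisYaffe1985].
-/

set_option autoImplicit false

noncomputable section

namespace Summit.QuantumFields.YangMills.Theorems.VirialFluxGap.RingDeficit

/-- ★★ **`WindowArithmetic`** (the Prop of stub `stub_windowArithmetic` of LINE «tauber» on crux stmt-QuantumFields-24204, verbatim): on Laplace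
windows `L ≤ β^a`, `a := 1/(4(2q₁+9))`, the three Tauberian thresholds hold and the error repackages as `(40K₁+8)L^{q₁+4}/β`.
No crux / rung / summit is proved; the YM mass gap is NOT proved. [cite: Luscher1983, §2] -/
theorem windowArithmetic :
    ∀ K₁ q₁ : ℝ, 0 < K₁ → 0 ≤ q₁ → ∃ a : ℝ, 0 < a ∧ ∃ β₀ : ℝ, ∀ β : ℝ, β₀ ≤ β → ∀ L : ℕ, 1 ≤ L → (L : ℝ) ≤ β ^ a →
      ∀ w : ℝ, |w| ≤ K₁ * (L : ℝ) ^ q₁ →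
        2 ≤ β ∧
        2 * (K₁ * (L : ℝ) ^ q₁ * (((9 * L ^ 4 : ℕ) : ℝ) + 1) + 1) ≤ β ∧
        64 * (((9 * L ^ 4 : ℕ) : ℝ) + 2) ^ 2 * (1 + |w| + |Real.log ((K₁ * (L : ℝ) ^ q₁)⁻¹)| + Real.log β) ≤
          β * (K₁ * (L : ℝ) ^ q₁)⁻¹ ∧
        (4 * (K₁ * (L : ℝ) ^ q₁) * (((9 * L ^ 4 : ℕ) : ℝ) + 1) + 4) / β ≤ (40 * K₁ + 8) * (L : ℝ) ^ (q₁ + 4) / β := by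
  intro K₁ q₁ hK₁ hq₁
  set D₀ : ℝ := 2 * q₁ + 9 with hD₀
  have hD₀0 : 0 < D₀ := by rw [hD₀]; linarith
  set a : ℝ := 1 / (4 * D₀) with ha
  have ha0 : 0 < a := by rw [ha]; positivity
  set M : ℝ := 7744 * K₁ * (1 + K₁ + |Real.log K₁| + q₁ + 4) + 20 * K₁ + 2 with hM
  have hlogK : 0 ≤ |Real.log K₁| := abs_nonneg _
  have hM0 : 0 < M := by rw [hM]; positivity
  refine ⟨a, ha0, max 2 (M ^ 2), ?_⟩
  intro β hβ L hL hLa w hw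
  have hβ2 : 2 ≤ β := le_trans (le_max_left _ _) hβ
  have hβM : M ^ 2 ≤ β := le_trans (le_max_right _ _) hβ
  have hβ1 : 1 ≤ β := by linarith
  have hβ0 : 0 < β := by linarith
  have hℓ1 : (1 : ℝ) ≤ (L : ℝ) := by exact_mod_cast hL
  have hℓ0 : (0 : ℝ) < (L : ℝ) := by linarith
  -- `r = β^{1/4}`, `r·r = β^{1/2}`, `β^{1/2}·β^{1/2} = β`, `M ≤ β^{1/2}`
  set r : ℝ := β ^ (1 / 4 : ℝ) with hr
  have hr1 : 1 ≤ r := Real.one_le_rpow hβ1 (by norm_num)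
  have hr0 : 0 ≤ r := by linarith
  have hrr : r * r = β ^ (1 / 2 : ℝ) := by
    rw [hr, ← Real.rpow_add hβ0]; norm_num
  have hhalf : β ^ (1 / 2 : ℝ) * β ^ (1 / 2 : ℝ) = β := by
    rw [← Real.rpow_add hβ0]; norm_num
  have hMβ : M ≤ β ^ (1 / 2 : ℝ) := by
    rw [← Real.sqrt_eq_rpow, show M = Real.sqrt (M ^ 2) by rw [Real.sqrt_sq hM0.le]]
    exact Real.sqrt_le_sqrt hβM
  have hr_le_rr : r ≤ r * r := le_mul_of_one_le_right hr0 hr1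
  -- every monomial `L^s`, `0 ≤ s ≤ D₀`, is `≤ r`
  have hP : ∀ s : ℝ, 0 ≤ s → s ≤ D₀ → (L : ℝ) ^ s ≤ r := by
    intro s _ hs
    calc (L : ℝ) ^ s ≤ (L : ℝ) ^ D₀ := Real.rpow_le_rpow_of_exponent_le hℓ1 hs
      _ ≤ (β ^ a) ^ D₀ := Real.rpow_le_rpow hℓ0.le hLa hD₀0.le
      _ = β ^ (a * D₀) := (Real.rpow_mul hβ0.le a D₀).symm
      _ = r := by rw [hr]; congr 1; rw [ha]; field_simp
  have hpow : ∀ (k : ℕ) (s : ℝ), 0 ≤ s → (k : ℝ) + s ≤ D₀ → (L : ℝ) ^ k * (L : ℝ) ^ s ≤ r := by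
    intro k s hs hks
    have h1 : (L : ℝ) ^ k * (L : ℝ) ^ s = (L : ℝ) ^ ((k : ℝ) + s) := by
      rw [Real.rpow_add hℓ0, Real.rpow_natCast]
    rw [h1]
    exact hP _ (by positivity) hks
  -- the volume-law constant `κ = K₁ L^{q₁}`
  set κ : ℝ := K₁ * (L : ℝ) ^ q₁ with hκ
  have hLq1 : 1 ≤ (L : ℝ) ^ q₁ := Real.one_le_rpow hℓ1 hq₁
  have hLq0 : 0 < (L : ℝ) ^ q₁ := by linarith
  have hκK : K₁ ≤ κ := by rw [hκ]; exact le_mul_of_one_le_right hK₁.le hLq1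
  have hκ0 : 0 < κ := lt_of_lt_of_le hK₁ hκK
  have hn : (((9 * L ^ 4 : ℕ) : ℝ)) = 9 * (L : ℝ) ^ 4 := by push_cast; ring
  have hℓ4 : 1 ≤ (L : ℝ) ^ 4 := one_le_pow₀ hℓ1
  -- monomial bounds
  have hb44 : (L : ℝ) ^ 4 * (L : ℝ) ^ q₁ ≤ r := hpow 4 q₁ hq₁ (by rw [hD₀]; push_cast; linarith)
  have hb8 : (L : ℝ) ^ 8 * (L : ℝ) ^ q₁ ≤ r := hpow 8 q₁ hq₁ (by rw [hD₀]; push_cast; linarith)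
  have hb82 : (L : ℝ) ^ 8 * ((L : ℝ) ^ q₁ * (L : ℝ) ^ q₁) ≤ r := by
    rw [← Real.rpow_add hℓ0]
    exact hpow 8 (q₁ + q₁) (by positivity) (by rw [hD₀]; push_cast; linarith)
  have hb9 : (L : ℝ) ^ 9 * (L : ℝ) ^ q₁ ≤ r := hpow 9 q₁ hq₁ (by rw [hD₀]; push_cast; linarith)
  -- translate to `κ`
  have hc1 : (L : ℝ) ^ 4 * κ ≤ K₁ * r := by
    rw [hκ, show (L : ℝ) ^ 4 * (K₁ * (L : ℝ) ^ q₁) = K₁ * ((L : ℝ) ^ 4 * (L : ℝ) ^ q₁) by ring]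
    exact mul_le_mul_of_nonneg_left hb44 hK₁.le
  have hc2 : (L : ℝ) ^ 8 * κ ≤ K₁ * r := by
    rw [hκ, show (L : ℝ) ^ 8 * (K₁ * (L : ℝ) ^ q₁) = K₁ * ((L : ℝ) ^ 8 * (L : ℝ) ^ q₁) by ring]
    exact mul_le_mul_of_nonneg_left hb8 hK₁.le
  have hc3 : (L : ℝ) ^ 8 * κ * κ ≤ K₁ * K₁ * r := by
    rw [hκ]
    have : (L : ℝ) ^ 8 * (K₁ * (L : ℝ) ^ q₁) * (K₁ * (L : ℝ) ^ q₁) =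
        K₁ * K₁ * ((L : ℝ) ^ 8 * ((L : ℝ) ^ q₁ * (L : ℝ) ^ q₁)) := by ring
    rw [this]
    exact mul_le_mul_of_nonneg_left hb82 (by positivity)
  have hc4 : (L : ℝ) ^ 8 * κ * (L : ℝ) ≤ K₁ * r := by
    rw [hκ]
    have : (L : ℝ) ^ 8 * (K₁ * (L : ℝ) ^ q₁) * (L : ℝ) = K₁ * ((L : ℝ) ^ 9 * (L : ℝ) ^ q₁) := by ring
    rw [this]
    exact mul_le_mul_of_nonneg_left hb9 hK₁.le
  -- `log β ≤ 4 r`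
  have hlogβ : Real.log β ≤ 4 * r := by
    have h := Real.log_le_rpow_div hβ0.le (by norm_num : (0 : ℝ) < 1 / 4)
    rw [hr]
    have : β ^ (1 / 4 : ℝ) / (1 / 4) = 4 * β ^ (1 / 4 : ℝ) := by ring
    linarith [this ▸ h]
  -- `|log κ⁻¹| ≤ |log K₁| + q₁ L`
  have hlogκ : |Real.log (κ⁻¹)| ≤ |Real.log K₁| + q₁ * (L : ℝ) := by
    rw [Real.log_inv, abs_neg, hκ, Real.log_mul hK₁.ne' hLq0.ne', Real.log_rpow hℓ0]
    have hlogL : 0 ≤ Real.log (L : ℝ) := Real.log_nonneg hℓ1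
    have hlogL' : Real.log (L : ℝ) ≤ (L : ℝ) := by
      have := Real.log_le_sub_one_of_pos hℓ0; linarith
    calc |Real.log K₁ + q₁ * Real.log (L : ℝ)| ≤ |Real.log K₁| + |q₁ * Real.log (L : ℝ)| := abs_add_le _ _
      _ = |Real.log K₁| + q₁ * Real.log (L : ℝ) := by rw [abs_of_nonneg (mul_nonneg hq₁ hlogL)]
      _ ≤ |Real.log K₁| + q₁ * (L : ℝ) := by
          have := mul_le_mul_of_nonneg_left hlogL' hq₁; linarith
  refine ⟨hβ2, ?_, ?_, ?_⟩
  · -- threshold 2: `2(κ(9L⁴+1)+1) ≤ β`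
    rw [hn]
    have hκℓ : κ ≤ (L : ℝ) ^ 4 * κ := le_mul_of_one_le_left hκ0.le hℓ4
    have h1 : 2 * (κ * (9 * (L : ℝ) ^ 4 + 1) + 1) ≤ 20 * ((L : ℝ) ^ 4 * κ) + 2 := by
      have e : 2 * (κ * (9 * (L : ℝ) ^ 4 + 1) + 1) = 18 * ((L : ℝ) ^ 4 * κ) + 2 * κ + 2 := by ring
      rw [e]; linarith
    have h2 : 20 * ((L : ℝ) ^ 4 * κ) + 2 ≤ (20 * K₁ + 2) * r := by
      have e : (20 * K₁ + 2) * r = 20 * (K₁ * r) + 2 * r := by ring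
      rw [e]; linarith
    have h3 : (20 * K₁ + 2) * r ≤ M * (r * r) := by
      have hpos : 0 ≤ 7744 * K₁ * (1 + K₁ + |Real.log K₁| + q₁ + 4) := by positivity
      have hle : 20 * K₁ + 2 ≤ M := by rw [hM]; linarith
      calc (20 * K₁ + 2) * r ≤ M * r := mul_le_mul_of_nonneg_right hle hr0
        _ ≤ M * (r * r) := mul_le_mul_of_nonneg_left hr_le_rr hM0.le
    rw [hrr] at h3
    have h4 : M * β ^ (1 / 2 : ℝ) ≤ β := by
      calc M * β ^ (1 / 2 : ℝ) ≤ β ^ (1 / 2 : ℝ) * β ^ (1 / 2 : ℝ) :=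
            mul_le_mul_of_nonneg_right hMβ (Real.rpow_nonneg hβ0.le _)
        _ = β := hhalf
    linarith
  · -- threshold 3: `64(9L⁴+2)²(1 + |w| + |log κ⁻¹| + log β) ≤ β/κ`
    rw [← div_eq_mul_inv, le_div_iff₀ hκ0, hn]
    have hsq : (9 * (L : ℝ) ^ 4 + 2) ^ 2 ≤ 121 * (L : ℝ) ^ 8 := by
      have h8 : 121 * (L : ℝ) ^ 8 - (9 * (L : ℝ) ^ 4 + 2) ^ 2 = 4 * ((10 * (L : ℝ) ^ 4 + 1) * ((L : ℝ) ^ 4 - 1)) := by ring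
      have hnn : 0 ≤ 4 * ((10 * (L : ℝ) ^ 4 + 1) * ((L : ℝ) ^ 4 - 1)) :=
        mul_nonneg (by norm_num) (mul_nonneg (by positivity) (sub_nonneg.mpr hℓ4))
      linarith
    have hS : 1 + |w| + |Real.log (κ⁻¹)| + Real.log β ≤ 1 + κ + |Real.log K₁| + q₁ * (L : ℝ) + 4 * r := by
      linarith
    have hS0 : 0 ≤ 1 + |w| + |Real.log (κ⁻¹)| + Real.log β := by
      have := Real.log_nonneg hβ1; positivity
    calc 64 * (9 * (L : ℝ) ^ 4 + 2) ^ 2 * (1 + |w| + |Real.log (κ⁻¹)| + Real.log β) * κ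
        ≤ 64 * (121 * (L : ℝ) ^ 8) * (1 + κ + |Real.log K₁| + q₁ * (L : ℝ) + 4 * r) * κ := by
          have h1 : 64 * (9 * (L : ℝ) ^ 4 + 2) ^ 2 * (1 + |w| + |Real.log (κ⁻¹)| + Real.log β) ≤
              64 * (121 * (L : ℝ) ^ 8) * (1 + κ + |Real.log K₁| + q₁ * (L : ℝ) + 4 * r) :=
            mul_le_mul (mul_le_mul_of_nonneg_left hsq (by norm_num)) hS hS0 (by positivity)
          exact mul_le_mul_of_nonneg_right h1 hκ0.le
      _ = 7744 * ((L : ℝ) ^ 8 * κ + (L : ℝ) ^ 8 * κ * κ + |Real.log K₁| * ((L : ℝ) ^ 8 * κ) +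
            q₁ * ((L : ℝ) ^ 8 * κ * (L : ℝ)) + 4 * r * ((L : ℝ) ^ 8 * κ)) := by ring
      _ ≤ 7744 * (K₁ * r + K₁ * K₁ * r + |Real.log K₁| * (K₁ * r) + q₁ * (K₁ * r) + 4 * r * (K₁ * r)) := by
          have h3 := mul_le_mul_of_nonneg_left hc2 hlogK
          have h4 := mul_le_mul_of_nonneg_left hc4 hq₁
          have h5 : 4 * r * ((L : ℝ) ^ 8 * κ) ≤ 4 * r * (K₁ * r) := mul_le_mul_of_nonneg_left hc2 (by positivity)
          linarith
      _ ≤ 7744 * K₁ * (1 + K₁ + |Real.log K₁| + q₁ + 4) * (r * r) := by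
          have h1 : K₁ * r ≤ K₁ * (r * r) := mul_le_mul_of_nonneg_left hr_le_rr hK₁.le
          have h2 : K₁ * K₁ * r ≤ K₁ * K₁ * (r * r) := mul_le_mul_of_nonneg_left hr_le_rr (by positivity)
          have h3 : |Real.log K₁| * (K₁ * r) ≤ |Real.log K₁| * (K₁ * (r * r)) := mul_le_mul_of_nonneg_left h1 hlogK
          have h4 : q₁ * (K₁ * r) ≤ q₁ * (K₁ * (r * r)) := mul_le_mul_of_nonneg_left h1 hq₁
          have e : 7744 * K₁ * (1 + K₁ + |Real.log K₁| + q₁ + 4) * (r * r) =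
              7744 * (K₁ * (r * r) + K₁ * K₁ * (r * r) + |Real.log K₁| * (K₁ * (r * r)) + q₁ * (K₁ * (r * r)) +
                4 * r * (K₁ * r)) := by ring
          rw [e]; linarith
      _ ≤ M * (r * r) := by
          have : 7744 * K₁ * (1 + K₁ + |Real.log K₁| + q₁ + 4) ≤ M := by rw [hM]; linarith
          exact mul_le_mul_of_nonneg_right this (by positivity)
      _ = M * β ^ (1 / 2 : ℝ) := by rw [hrr]
      _ ≤ β ^ (1 / 2 : ℝ) * β ^ (1 / 2 : ℝ) := mul_le_mul_of_nonneg_right hMβ (Real.rpow_nonneg hβ0.le _)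
      _ = β := hhalf
  · -- error repackaging: `(4κ(9L⁴+1)+4)/β ≤ (40K₁+8) L^{q₁+4}/β`
    refine div_le_div_of_nonneg_right ?_ hβ0.le
    have h4 : (L : ℝ) ^ (4 : ℝ) = (L : ℝ) ^ 4 := by exact_mod_cast (Real.rpow_natCast (L : ℝ) 4)
    rw [hn, Real.rpow_add hℓ0, h4, hκ]
    have h1 : 1 ≤ (L : ℝ) ^ q₁ * (L : ℝ) ^ 4 := one_le_mul_of_one_le_of_one_le hLq1 hℓ4
    have hA : K₁ * (L : ℝ) ^ q₁ ≤ K₁ * ((L : ℝ) ^ q₁ * (L : ℝ) ^ 4) :=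
      mul_le_mul_of_nonneg_left (le_mul_of_one_le_right hLq0.le hℓ4) hK₁.le
    have hB : 0 ≤ K₁ * ((L : ℝ) ^ q₁ * (L : ℝ) ^ 4) := by positivity
    have e1 : 4 * (K₁ * (L : ℝ) ^ q₁) * (9 * (L : ℝ) ^ 4 + 1) + 4 =
        36 * (K₁ * ((L : ℝ) ^ q₁ * (L : ℝ) ^ 4)) + 4 * (K₁ * (L : ℝ) ^ q₁) + 4 := by ring
    have e2 : (40 * K₁ + 8) * ((L : ℝ) ^ q₁ * (L : ℝ) ^ 4) =
        40 * (K₁ * ((L : ℝ) ^ q₁ * (L : ℝ) ^ 4)) + 8 * ((L : ℝ) ^ q₁ * (L : ℝ) ^ 4) := by ring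
    rw [e1, e2]
    linarith

end Summit.QuantumFields.YangMills.Theorems.VirialFluxGap.RingDeficit

end
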